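import Summits.ResolutionOfSingularities.ResolutionOfSingularities.Theorems.WeightedInvariantIota3TauEssSmoothOfDescent
import Summits.ResolutionOfSingularities.ResolutionOfSingularities.Theorems.WeightedInvariantIota3Regimes
import Summits.ResolutionOfSingularities.ResolutionOfSingularities.Theorems.WeightedInvariantJFlatEssSmoothPoint
import Summits.ResolutionOfSingularities.ResolutionOfSingularities.Theorems.WeightedInvariantEssSmoothMonomialTypeDescent
import HarnessLib

/-!
# (desc-τ), FIRST CASES: no tie position at monomial type, none over a base of dimension `≤ 1`, and the reduction of the
# descent of tie positions to its two real cases (door `HypersurfaceCentreConstruction`, stmt-ResolutionOfSingularities-19897;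
# registered stub `stub_keyRungGrHomLE_three`, gap (1) (desc-τ) of `keyRungGrHomLE_three_of_descent'`)

Topic: `Summits/ResolutionOfSingularities/ResolutionOfSingularities/Theorems`. Helper for the door item `HypersurfaceCentreConstruction`
(stmt-ResolutionOfSingularities-19897, route `WeightedInvariant`), line `local-engine`, def-free.  The gap list of the registered stub
`stub_keyRungGrHomLE_three` after hand leafhand-res-weightedinvariant-3 g0 (`keyRungGrHomLE_three_of_descent'`,
…IotaFlatTUpperSemicontinuousGraded) opens with

  (desc-τ) `∀ φ : T → T'` local, formally smooth, essentially of finite type, `T`, `T'` regular local, `dim T' ≤ 3`: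
  `IsTiePosition T' (φ g) → IsTiePosition T g`.

THIS FILE settles its elementary cases and isolates the two real ones:

* §1 **`Iota3.not_isTiePosition_of_isMonomialType`** — a position of MONOMIAL TYPE (`f = v·gⁿ`, `g ∈ 𝔪 ∖ 𝔪²`) is never a tie
  position: its top `(ν ; ε)`-stratum is the regular divisor `V(g)` (`topStratumPrime_iotaOrdEps_of_eq_unit_mul_pow`), so
  `dim R ⧸ P₀ = dim R - 1 = 2 ≠ 1`.
* §2 **`Iota3.not_isTiePosition_map_of_ringKrullDim_le_one`** — NO TIE OVER A BASE OF DIMENSION `≤ 1`: for `dim T ≤ 1` the equation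
  `g` is `0`, a unit, or of monomial type (`EssSmoothLE2.isMonomialType_of_ringKrullDim_le_one`), and monomial type ascends
  (`EssSmoothDescent.isMonomialType_map`).  `Iota3.ringKrullDim_eq_of_isTiePosition_map`: a tie upstairs forces `dim T' = 3` and
  `dim T ∈ {2, 3}`.
* §3 **`Iota3.isTiePosition_descent_of_cases`** — (desc-τ) ⟸ (A′) «no tie over a base of dimension EXACTLY `2` into dimension `3`» ∧
  (B) «tie positions descend along `φ` at equal dimension `3` with `𝔪_T T' = 𝔪_{T'}`» (the relative-dimension-zero identity is
  supplied by `EssSmoothLE2.map_maximalIdeal_eq_of_ringKrullDim_eq`); hence `Iota3.iotaTau_essSmooth_eq_of_cases` ((c11τ)≤3 from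
  the two cases, via `iotaTau_essSmooth_eq_of_descent`).

[OURS · L1 W4.3 · (desc-τ) first cases]  Replaces the role of NO printed item; NOT a statement of the manuscript under review
[claim: Hironaka2017, status: under-review]; candidates stay candidates; AI work, weaker than expert review.  No definition; no axiom.

## References

* H. Matsumura, *Commutative Ring Theory* (1986), Thm. 14.2, Thm. 15.1, §22 Cor. to Thm. 22.5. [Matsumura1987]
* D. Abramovich, M. H. Quek, B. Schober, arXiv:2507.01232 (2025), Thm 1.3. [AbramovichQuekSchober2025]
-/

noncomputable section

set_option linter.dupNamespace false -- mandated namespace `Summit.<Summit>.<Problem>` of this single-conjunct summit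

open IsLocalRing Literature.AlgebraicGeometry.Resolution
open Summit.ResolutionOfSingularities.ResolutionOfSingularities.Theorems
open Summit.ResolutionOfSingularities.ResolutionOfSingularities.Theorems.ContactCylinder

namespace Summit.ResolutionOfSingularities.ResolutionOfSingularities.Cruxes.HypersurfaceCentreConstruction.LocalEngine

namespace Iota3

/-! ## §1 No tie position at monomial type -/

section Monomial

variable {R : Type} [CommRing R] [IsRegularLocalRing R]

/-- **At monomial type the generic prime of the top `(ν ; ε)`-stratum is `(g)`**: for `f = v·gⁿ` (`v` a unit, `g ∈ 𝔪 ∖ 𝔪²`, `n ≥ 1`)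
`ε(R, f) = 0` and `Σ(R, f) = V(g)`, so `topStratumPrime iotaOrdEps R f = (g)`. [OURS] -/
theorem topStratumPrime_iotaOrdEps_of_eq_unit_mul_pow {v g f : R} (hv : IsUnit v) (hg : g ∈ maximalIdeal R)
    (hg2 : g ∉ maximalIdeal R ^ 2) {n : ℕ} (hn : 0 < n) (hf : f = v * g ^ n) :
    topStratumPrime iotaOrdEps R f = Ideal.span {g} := by
  obtain ⟨hP, -, hfg, -⟩ := IotaOrderStrat.strat_of_eq_unit_mul_pow hv hg hg2 hn hf
  have hf𝔪 : f ∈ maximalIdeal R :=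
    (Ideal.span_le.mpr (Set.singleton_subset_iff.mpr hg) : Ideal.span {g} ≤ maximalIdeal R) hfg
  have hfu : ¬ IsUnit f := fun h => (IsLocalRing.mem_maximalIdeal f).mp hf𝔪 h
  have hε : iotaEps R f = 0 := JFlatEssSmooth.iotaEps_eq_zero_of_isMonomialType R hfu ⟨v, g, n, hv, hg, hg2, hf⟩
  have hE : topStratum iotaOrdEps R f = {𝔮 | Ideal.span {g} ≤ 𝔮.asIdeal} := by
    rw [topStratum_iotaOrdEps_eq_topStratum_iotaOrd_of_iotaEps_eq_zero hf𝔪 hε]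
    exact topStratum_iotaOrd_of_eq_unit_mul_pow hv hg hg2 hn hf
  haveI := hP
  exact ContactCylinder.topStratumPrime_eq_of_topStratum_eq iotaOrdEps R f hE

/-- **A POSITION OF MONOMIAL TYPE IS NEVER A TIE POSITION.**  For `f = v·gⁿ` the top `(ν ; ε)`-stratum is the regular divisor `V(g)`, so
`dim R ⧸ P₀ = dim R - 1`; at a tie position `dim R = 3` and `dim R ⧸ P₀ = 1`. [OURS · (desc-τ) first cases]
[cite: Matsumura1987, Thm. 14.2] -/
theorem not_isTiePosition_of_isMonomialType {f : R} (hm : IsMonomialType f) : ¬ IsTiePosition R f := by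
  intro ht
  obtain ⟨v, g, n, hv, hg, hg2, hf⟩ := hm
  have hf𝔪 : f ∈ maximalIdeal R := ht.mem_maximalIdeal
  have hn : 0 < n := by
    rcases Nat.eq_zero_or_pos n with h0 | h
    · exfalso
      rw [h0, pow_zero, mul_one] at hf
      rw [hf] at hf𝔪
      exact (IsLocalRing.mem_maximalIdeal v).mp hf𝔪 hv
    · exact h
  have hP := topStratumPrime_iotaOrdEps_of_eq_unit_mul_pow hv hg hg2 hn hf
  obtain ⟨_, hdim, -, hq1, -⟩ := ht
  haveI := isDomain_of_isRegularLocalRing R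
  have hg0 : g ≠ 0 := fun h => hg2 (by rw [h]; exact zero_mem _)
  have hkey := ringKrullDim_quotient_span_singleton_succ_eq_ringKrullDim_of_mem_nonZeroDivisors
    (mem_nonZeroDivisors_of_ne_zero hg0) hg
  have hcongr : ∀ (I J : Ideal R), I = J → ringKrullDim (R ⧸ I) = ringKrullDim (R ⧸ J) := by
    rintro I J rfl; rfl
  rw [← hcongr _ _ hP, hq1, hdim] at hkey
  -- `1 + 1 = 3` in `WithBot ℕ∞` is absurd
  have h' : ((1 + 1 : ℕ) : WithBot ℕ∞) = ((3 : ℕ) : WithBot ℕ∞) := by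
    have h1 : ((1 : ℕ) : WithBot ℕ∞) + 1 = 3 := hkey
    exact_mod_cast h1
  have h'' : (1 + 1 : ℕ) = 3 := by exact_mod_cast h'
  omega

end Monomial

/-! ## §2 No tie position over a base of dimension `≤ 1`; the dimensions at a tie -/

section Base

variable (T T' : Type) [CommRing T] [CommRing T'] [IsRegularLocalRing T] [IsRegularLocalRing T'] [Algebra T T']
  [IsLocalHom (algebraMap T T')] [Algebra.FormallySmooth T T'] [Algebra.EssFiniteType T T']

/-- **NO TIE POSITION OVER A BASE OF DIMENSION `≤ 1`.**  Along a local, formally smooth, essentially-of-finite-type homomorphism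
`φ : T → T'` of regular local rings with `dim T ≤ 1`, `(T', φ g)` is never a tie position: `g` is `0` (no tie: `IsTiePosition.ne_zero`), a unit
(no tie: a tie lies in `𝔪'`), or of monomial type (`T` is a field or a discrete valuation ring), and monomial type ascends along `φ`
(`EssSmoothDescent.isMonomialType_map`) — excluded by `not_isTiePosition_of_isMonomialType`. [OURS · (desc-τ) first cases]
[cite: Matsumura1987, §22 Cor. to Thm. 22.5] -/
theorem not_isTiePosition_map_of_ringKrullDim_le_one (hdim : ringKrullDim T ≤ 1) (g : T) :
    ¬ IsTiePosition T' (algebraMap T T' g) := by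
  intro ht
  by_cases hg0 : g = 0
  · exact ht.ne_zero (by rw [hg0, map_zero])
  by_cases hgu : IsUnit g
  · exact (IsLocalRing.mem_maximalIdeal _).mp ht.mem_maximalIdeal (hgu.map (algebraMap T T'))
  · exact not_isTiePosition_of_isMonomialType
      (EssSmoothDescent.isMonomialType_map (EssSmoothLE2.isMonomialType_of_ringKrullDim_le_one hdim hg0 hgu)) ht

/-- **The dimensions at a tie upstairs**: if `(T', φ g)` is a tie position then `dim T' = 3` and `dim T ∈ {2, 3}` (`dim T ≤ dim T'` by flatness,
`dim T ≥ 2` by `not_isTiePosition_map_of_ringKrullDim_le_one`). [OURS · (desc-τ) first cases] [cite: Matsumura1987, Thm. 15.1] -/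
theorem ringKrullDim_eq_of_isTiePosition_map {g : T} (ht : IsTiePosition T' (algebraMap T T' g)) :
    ringKrullDim T' = (3 : ℕ) ∧ (ringKrullDim T = (2 : ℕ) ∨ ringKrullDim T = (3 : ℕ)) := by
  obtain ⟨a, b, c, ha, hb, -, habc⟩ := EssSmoothLE2.exists_dims T T'
  have h3 : ringKrullDim T' = 3 := ringKrullDim_eq_three_of_isTiePosition ht
  have hb3 : b = 3 := by rw [hb] at h3; exact_mod_cast h3
  have ha1 : ¬ a ≤ 1 := fun h =>
    not_isTiePosition_map_of_ringKrullDim_le_one T T' (by rw [ha]; exact_mod_cast h) g ht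
  refine ⟨by rw [hb, hb3], ?_⟩
  have h23 : a = 2 ∨ a = 3 := by omega
  rcases h23 with h | h
  · exact Or.inl (by rw [ha, h])
  · exact Or.inr (by rw [ha, h])

end Base

/-! ## §3 The descent of tie positions, reduced to its two real cases -/

/-- **(desc-τ) FROM ITS TWO REAL CASES.**  The descent of tie positions along local, formally smooth, essentially-of-finite-type homomorphisms
`φ : T → T'` of regular local rings into dimension `≤ 3` follows from
* (A′) «no tie over a base of dimension two»: `dim T = 2`, `dim T' = 3` ⇒ `(T', φ g)` is not a tie position; and
* (B) «equal-dimension descent»: `dim T = dim T' = 3`, `𝔪_T T' = 𝔪_{T'}` ⇒ `IsTiePosition T' (φ g) → IsTiePosition T g`;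
the cases `dim T ≤ 1` / `dim T' ≠ 3` being `§2`, and `𝔪_T T' = 𝔪_{T'}` at equal dimension being
`EssSmoothLE2.map_maximalIdeal_eq_of_ringKrullDim_eq`. [OURS · (desc-τ) reduction] [cite: Matsumura1987, Thm. 15.1 and Thm. 23.7] -/
theorem isTiePosition_descent_of_cases
    (hA : ∀ (T T' : Type) [CommRing T] [IsRegularLocalRing T] [CommRing T'] [IsRegularLocalRing T'] [Algebra T T']
      [IsLocalHom (algebraMap T T')] [Algebra.FormallySmooth T T'] [Algebra.EssFiniteType T T'] (g : T),
      ringKrullDim T = (2 : ℕ) → ringKrullDim T' = (3 : ℕ) → ¬ IsTiePosition T' (algebraMap T T' g))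
    (hB : ∀ (T T' : Type) [CommRing T] [IsRegularLocalRing T] [CommRing T'] [IsRegularLocalRing T'] [Algebra T T']
      [IsLocalHom (algebraMap T T')] [Algebra.FormallySmooth T T'] [Algebra.EssFiniteType T T'] (g : T),
      ringKrullDim T = (3 : ℕ) → ringKrullDim T' = (3 : ℕ) → (maximalIdeal T).map (algebraMap T T') = maximalIdeal T' →
      IsTiePosition T' (algebraMap T T' g) → IsTiePosition T g) :
    ∀ (T T' : Type) [CommRing T] [IsRegularLocalRing T] [CommRing T'] [IsRegularLocalRing T'] [Algebra T T']
      [IsLocalHom (algebraMap T T')] [Algebra.FormallySmooth T T'] [Algebra.EssFiniteType T T'] (g : T),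
      ringKrullDim T' ≤ 3 → IsTiePosition T' (algebraMap T T' g) → IsTiePosition T g := by
  intro T T' _ _ _ _ _ _ _ _ g _ ht
  obtain ⟨h3, h2 | h3'⟩ := ringKrullDim_eq_of_isTiePosition_map T T' ht
  · exact absurd ht (hA T T' g h2 h3)
  · exact hB T T' g h3' h3 (EssSmoothLE2.map_maximalIdeal_eq_of_ringKrullDim_eq T T' (by rw [h3, h3'])) ht

/-- **(c11τ)≤3 FROM THE TWO REAL CASES of (desc-τ)** (`iotaTau_essSmooth_eq_of_descent` ∘ `isTiePosition_descent_of_cases`): `τ(S', φ f) = τ(S, f)`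
along every local, formally smooth, essentially-of-finite-type `φ : S → S'` of regular local rings with `dim S' ≤ 3`. [OURS · audit glue] -/
theorem iotaTau_essSmooth_eq_of_cases
    (hA : ∀ (T T' : Type) [CommRing T] [IsRegularLocalRing T] [CommRing T'] [IsRegularLocalRing T'] [Algebra T T']
      [IsLocalHom (algebraMap T T')] [Algebra.FormallySmooth T T'] [Algebra.EssFiniteType T T'] (g : T),
      ringKrullDim T = (2 : ℕ) → ringKrullDim T' = (3 : ℕ) → ¬ IsTiePosition T' (algebraMap T T' g))
    (hB : ∀ (T T' : Type) [CommRing T] [IsRegularLocalRing T] [CommRing T'] [IsRegularLocalRing T'] [Algebra T T']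
      [IsLocalHom (algebraMap T T')] [Algebra.FormallySmooth T T'] [Algebra.EssFiniteType T T'] (g : T),
      ringKrullDim T = (3 : ℕ) → ringKrullDim T' = (3 : ℕ) → (maximalIdeal T).map (algebraMap T T') = maximalIdeal T' →
      IsTiePosition T' (algebraMap T T' g) → IsTiePosition T g)
    (S S' : Type) [CommRing S] [IsRegularLocalRing S] [CommRing S'] [IsRegularLocalRing S'] [Algebra S S']
    [IsLocalHom (algebraMap S S')] [Algebra.FormallySmooth S S'] [Algebra.EssFiniteType S S'] (f : S) (hd : ringKrullDim S' ≤ 3) :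
    iotaTau S' (algebraMap S S' f) = iotaTau S f :=
  iotaTau_essSmooth_eq_of_descent (isTiePosition_descent_of_cases hA hB) S S' f hd

end Iota3

end Summit.ResolutionOfSingularities.ResolutionOfSingularities.Cruxes.HypersurfaceCentreConstruction.LocalEngine

end
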